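import Literature.Probability.LatticeModels.DobrushinShlosmanUniqueness
import Literature.Probability.LatticeModels.DobrushinShlosmanContractionBulk
import HarnessLib

/-!
# The Dobrushin–Shlosman window comparison in infinite volume under the AVERAGED condition:
# boundary insensitivity of the kernels and uniqueness in a region with frozen exterior

Topic `Literature/Probability/LatticeModels`; theorems only (no definitions, no named facts).

This is the companion of `DobrushinShlosmanUniqueness.lean` (Dobrushin–Shlosman 1985, Thm. 1, Vasserstein
form, arbitrary index set `V`) with two changes dictated by the applications to finite-volume MIXING
hypotheses (Chatterjee 2021, Def. 2.3; Martinelli–Olivieri) and to systems living in a SUBREGION of the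
index set with a frozen exterior (slabs, half-spaces, boxes with a fixed boundary condition):

* the received-sum hypothesis is Dobrushin–Shlosman's genuine condition `C_V`, AVERAGED over the centres
  whose window contains the cell — `Σ_{c : x ∈ win c} Σ_y K c y x ≤ γ₀ · #{c : x ∈ win c}` (the finite set
  of such centres is the datum `cover x`) — together with a crude uniform bound
  `Σ_{c : x ∈ win c} Σ_y K c y x ≤ Γ`; the contraction runs through `abs_sub_le_exp_bulk`
  (`DobrushinShlosmanContractionBulk.lean`), which needs the averaged condition only in the bulk;
* a window is usable for the comparison of `γ_Λ(·|ω)` with `γ_Λ(·|η)` as soon as `win c ⊆ Λ` and the two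
  boundary conditions AGREE on the part of its locality set `nbhd c` outside `Λ` (the tree's wrapper asks
  `nbhd c ⊆ Λ`, which no window of a slab system with frozen faces satisfies).

Results:

* `abs_integral_sub_integral_le_of_window_bulk` — for a finite volume `Λ`, boundary conditions `ω, η`, a
  profile `ℓ` such that every window around a cell of positive profile has its centre and window inside `Λ`
  and reads the exterior of `Λ` only where `ω = η`, and `ℓ` drops by at most one along the support of `K`:
  `|γ_Λ F(ω) − γ_Λ F(η)| ≤ 2 R e^{−κ L₀} Σ_{x ∈ Λ} δ x`, `κ = (1−γ₀)²/(2(2Γ+1))`, for every bounded measurable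
  `Λ`-local `F` whose site-Lipschitz vector `δ` vanishes below level `L₀`.
* `integral_eq_of_dlrOn_window_bulk`, `measure_eq_of_dlrOn_window_bulk` — **uniqueness in a region `W`
  with frozen exterior**: two probability measures concentrated on `{σ = ζ off W}` and satisfying the DLR
  equations for the kernels `γ_Λ`, `Λ ⊆ W` finite, agree on bounded local Lipschitz observables — hence
  coincide when these determine measures — provided every finite `Δ` and depth `L₀` admit a finite
  `Λ ⊆ W`, `Δ ⊆ Λ`, with an adapted profile `≥ L₀` on `Δ` whose positive-profile windows read the exterior
  of `Λ` only inside the frozen set `Wᶜ` (Georgii 2011 Thm. 8.20-type statement for windows; `W = univ`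
  is Dobrushin–Shlosman's uniqueness theorem under `C_V`).

References: R. L. Dobrushin, S. B. Shlosman, *Constructive criterion for the uniqueness of Gibbs field*
(1985), Thm. 1 and §2; F. Martinelli, LNM 1717 (1999) Thm. 2.4 / §2.4; H.-O. Georgii, *Gibbs Measures and
Phase Transitions* (2011) Thm. 8.20, §8.2; H. Föllmer, LNM 1362 (1988) Ch. I (2.7)–(2.10); the tree files
`DobrushinShlosmanUniqueness.lean` (followed line by line), `DobrushinShlosmanContractionBulk.lean`.
-/

noncomputable section

open MeasureTheory ProbabilityTheory Finset Function
open Literature.Probability.LatticeModels.DobrushinMetric (IsLipBound integrable_of_abs_le'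
  abs_sub_le_mul_sum_of_dependsOn measure_eq_of_forall_integral_eq_of_isLipBound)

namespace Literature.Probability.LatticeModels.DobrushinShlosman

variable {V S : Type*} [MeasurableSpace S]

/-! ### Small measure-theoretic helpers -/

/-- Freezing one coordinate to a constant is measurable. [folklore] -/
private theorem measurable_update_const'' [DecidableEq V] (y : V) (a : S) :
    Measurable fun σ : V → S => Function.update σ y a := by
  refine measurable_pi_iff.2 fun z => ?_
  by_cases hz : z = y
  · subst hz
    simp only [Function.update_self]
    exact measurable_const
  · simp only [Function.update_of_ne hz]
    exact measurable_pi_apply z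

/-- Two averages, under two probability measures, of a bounded measurable function whose oscillation is
`≤ A` between configurations satisfying two ALMOST SURE constraints differ by at most `A`. [folklore] -/
private theorem abs_integral_sub_integral_le_of_osc_ae {μ ν : Measure (V → S)} [IsProbabilityMeasure μ]
    [IsProbabilityMeasure ν] {h : (V → S) → ℝ} (hm : Measurable h) {B : ℝ} (hB : ∀ σ, |h σ| ≤ B)
    {P Q : (V → S) → Prop} (hP : ∀ᵐ σ ∂μ, P σ) (hQ : ∀ᵐ τ ∂ν, Q τ)
    {A : ℝ} (hosc : ∀ σ τ, P σ → Q τ → |h σ - h τ| ≤ A) :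
    |(∫ σ, h σ ∂μ) - ∫ τ, h τ ∂ν| ≤ A := by
  -- adapted from `DobrushinShlosmanUniqueness` (private `abs_integral_sub_integral_le_of_osc'`), a.e. form
  have hiμ : Integrable h μ := integrable_of_abs_le' hm hB
  have hiν : Integrable h ν := integrable_of_abs_le' hm hB
  have hpt : ∀ σ, P σ → |h σ - ∫ τ, h τ ∂ν| ≤ A := fun σ hσ => by
    have e : h σ - ∫ τ, h τ ∂ν = ∫ τ, (h σ - h τ) ∂ν := by
      rw [integral_sub (integrable_const _) hiν, integral_const, smul_eq_mul, probReal_univ, one_mul]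
    rw [e]
    calc |∫ τ, (h σ - h τ) ∂ν| ≤ ∫ τ, |h σ - h τ| ∂ν := abs_integral_le_integral_abs
      _ ≤ ∫ _τ, A ∂ν := by
          refine integral_mono_ae ((integrable_const _).sub hiν).abs (integrable_const A) ?_
          filter_upwards [hQ] with τ hτ using hosc σ τ hσ hτ
      _ = A := by simp
  have e : (∫ σ, h σ ∂μ) - ∫ τ, h τ ∂ν = ∫ σ, (h σ - ∫ τ, h τ ∂ν) ∂μ := by
    rw [integral_sub hiμ (integrable_const _), integral_const, smul_eq_mul, probReal_univ, one_mul]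
  rw [e]
  calc |∫ σ, (h σ - ∫ τ, h τ ∂ν) ∂μ| ≤ ∫ σ, |h σ - ∫ τ, h τ ∂ν| ∂μ := abs_integral_le_integral_abs
    _ ≤ ∫ _σ, A ∂μ := by
        refine integral_mono_ae (hiμ.sub (integrable_const _)).abs (integrable_const A) ?_
        filter_upwards [hP] with σ hσ using hpt σ hσ
    _ = A := by simp

/-- **One DLR equation, for observables** (Georgii 2011, Remark 1.24): if the probability measure `μ`
satisfies `∫ γ_Λ(A|η) dμ(η) = μ(A)` for ONE finite volume `Λ`, then `∫ (∫ f dγ_Λ(·|η)) dμ(η) = ∫ f dμ`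
for every `μ`-integrable `f`. [cite: Georgii2011, Rem. 1.24] -/
private theorem integral_integral_eq_of_dlr' {γ : Specification V S} (hγ : IsSpecification γ)
    {μ : Measure (V → S)} [IsProbabilityMeasure μ] (Λ : Finset V)
    (hDLR : ∀ A : Set (V → S), MeasurableSet A → ∫⁻ η, γ Λ η A ∂μ = μ A)
    {f : (V → S) → ℝ} (hf : Integrable f μ) :
    ∫ η, ∫ σ, f σ ∂(γ Λ η) ∂μ = ∫ σ, f σ ∂μ := by
  -- adapted from `Literature.MathematicalPhysics.QuantumLattice.DobrushinFrozen.integral_integral_eq_of_dlr`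
  let κ : Kernel (V → S) (V → S) := ⟨γ Λ, hγ.measurable_fun Λ⟩
  have hbind : μ.bind (γ Λ) = μ := by
    ext A hA
    rw [Measure.bind_apply hA (hγ.measurable_fun Λ).aemeasurable]
    exact hDLR A hA
  have hcomp : (κ ∘ₖ Kernel.const Unit μ) () = μ := by
    rw [Kernel.comp_apply, Kernel.const_apply]
    exact hbind
  have hfi : Integrable f ((κ ∘ₖ Kernel.const Unit μ) ()) := by rwa [hcomp]
  have key := Kernel.integral_comp hfi
  rw [hcomp, Kernel.const_apply] at key
  exact key.symm

/-! ### Exponential insensitivity of the kernels to the boundary condition, averaged condition -/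

/-- ★ **Dobrushin–Shlosman under the averaged condition `C_V`: the finite-volume kernels forget the part of
the boundary condition not read by the usable windows, exponentially fast in the depth** (Dobrushin–Shlosman
1985, Thm. 1 and its exponential estimate; Martinelli 1999, Thm. 2.4 — Vasserstein form, arbitrary measurable
spin space, arbitrary index set). Data: a specification `γ` on `V → S`; a site weight `0 ≤ r ≤ R`; windows
`win c ∋ c` with locality sets `nbhd c`; an array `K ≥ 0` supported in `y ∈ nbhd c` with the
one-boundary-site window contraction (H1) `hcontract` and the locality `hloc` of the window kernels; for every
cell `x` the finite set `cover x` of the centres whose window contains `x`, with the crude received-sum bound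
`Σ_{c ∈ cover x} Σ_{y ∈ nbhd c} K c y x ≤ Γ` and the AVERAGED bound
`Σ_{c ∈ cover x} Σ_{y ∈ nbhd c} K c y x ≤ γ₀ · |cover x|`, `γ₀ < 1`. Then for a finite volume `Λ`, boundary
conditions `ω, η`, a profile `ℓ : V → ℕ` such that every window around a cell of positive profile has its
centre in `Λ`, its window inside `Λ`, and reads the exterior of `Λ` only where `ω = η`, with `ℓ` dropping by
at most one from `x ∈ win c` to `y` with `K c y x ≠ 0`, and a bounded measurable `Λ`-local `F` with
site-Lipschitz vector `δ` vanishing where `ℓ < L₀`: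
`|∫ F dγ_Λ(·|ω) − ∫ F dγ_Λ(·|η)| ≤ 2 R e^{−(1−γ₀)² L₀/(2(2Γ+1))} Σ_{x ∈ Λ} δ x`.
[cite: DobrushinShlosman1985, Theorem 1] -/
theorem abs_integral_sub_integral_le_of_window_bulk [DecidableEq V] {γ : Specification V S}
    (hγ : IsSpecification γ)
    {r : S → S → ℝ} {R : ℝ} (hr0 : ∀ a b, 0 ≤ r a b) (hrR : ∀ a b, r a b ≤ R) (hR : 0 ≤ R)
    {win nbhd : V → Finset V} {K : V → V → V → ℝ} (hK0 : ∀ c y x, 0 ≤ K c y x)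
    (hKsupp : ∀ c y x, K c y x ≠ 0 → y ∈ nbhd c)
    (hcontract : ∀ (c y : V), y ∉ win c → ∀ (ω η : V → S), (∀ v, v ≠ y → ω v = η v) →
      ∀ (f : (V → S) → ℝ) (δ : V → ℝ), Measurable f → (∃ B, ∀ σ, |f σ| ≤ B) →
        DependsOn f (win c : Set V) → (∀ x, 0 ≤ δ x) →
        (∀ (x : V) (σ τ : V → S), (∀ v, v ≠ x → σ v = τ v) → |f σ - f τ| ≤ δ x * r (σ x) (τ x)) →
          |∫ σ, f σ ∂(γ (win c) ω) - ∫ σ, f σ ∂(γ (win c) η)| ≤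
            (∑ x ∈ win c, K c y x * δ x) * r (ω y) (η y))
    (hloc : ∀ (c : V) (ζ ζ' : V → S), (∀ v ∈ nbhd c, ζ v = ζ' v) →
      ∀ (f : (V → S) → ℝ), Measurable f → (∃ B, ∀ σ, |f σ| ≤ B) → DependsOn f (win c : Set V) →
        ∫ σ, f σ ∂(γ (win c) ζ) = ∫ σ, f σ ∂(γ (win c) ζ'))
    (Y : Set V) [DecidablePred (· ∈ Y)]
    (cover : V → Finset V) (hcover : ∀ c x, x ∈ win c ↔ c ∈ cover x)
    {γ₀ Γ : ℝ} (hγ₀ : 0 ≤ γ₀) (hγ₁ : γ₀ < 1) (hΓ : 0 ≤ Γ)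
    (hsum0 : ∀ x, ∑ c ∈ cover x, ∑ y ∈ (nbhd c).filter (· ∈ Y), K c y x ≤ Γ)
    (hsum : ∀ x, ∑ c ∈ cover x, ∑ y ∈ (nbhd c).filter (· ∈ Y), K c y x ≤ γ₀ * (cover x).card)
    (Λ : Finset V) (hΛY : (↑Λ : Set V) ⊆ Y) (hself : ∀ c ∈ Λ, c ∈ win c)
    (ω η : V → S) (ℓ : V → ℕ) (L₀ : ℕ)
    (hU : ∀ x, ℓ x ≠ 0 → ∀ c, x ∈ win c →
      c ∈ Λ ∧ win c ⊆ Λ ∧ ∀ v ∈ nbhd c, v ∉ Λ → ω v = η v)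
    (hℓ : ∀ c x y, x ∈ win c → K c y x ≠ 0 → ℓ x ≤ ℓ y + 1)
    {F : (V → S) → ℝ} (hFm : Measurable F) {B : ℝ} (hB : ∀ σ, |F σ| ≤ B)
    (hFdep : DependsOn F (Λ : Set V)) {δ : V → ℝ} (hδ : IsLipBound r F δ)
    (hδL : ∀ x, ℓ x < L₀ → δ x = 0) :
    |∫ σ, F σ ∂(γ Λ ω) - ∫ σ, F σ ∂(γ Λ η)| ≤
      2 * R * Real.exp (-((1 - γ₀) ^ 2 / (2 * (2 * Γ + 1)) * L₀)) * ∑ x ∈ Λ, δ x := by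
  -- adapted from `DobrushinShlosman.abs_integral_sub_integral_le_of_window`
  classical
  haveI := hγ.isProbability Λ ω
  haveI := hγ.isProbability Λ η
  -- genuine centres: window inside `Λ`, exterior part of the locality set frozen to a common value
  let Gen : V → Prop := fun c => win c ⊆ Λ ∧ ∀ v ∈ nbhd c, v ∉ Λ → ω v = η v
  -- extension of a vector on the cell type `↥Λ` by zero
  let ext : (↥Λ → ℝ) → V → ℝ := fun δ' v => if h : v ∈ Λ then δ' ⟨v, h⟩ else 0
  have ext_apply : ∀ (δ' : ↥Λ → ℝ) (x : ↥Λ), ext δ' x.1 = δ' x := fun δ' x => by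
    simp only [ext, dif_pos x.2]
  have ext_of_not_mem : ∀ (δ' : ↥Λ → ℝ) {v : V}, v ∉ Λ → ext δ' v = 0 := fun δ' v hv => by
    simp only [ext, dif_neg hv]
  -- admissible observables, Lipschitz vectors, window operators on `↥Λ`
  set Adm : ((V → S) → ℝ) → Prop := fun G =>
    Measurable G ∧ (∃ B, ∀ σ, |G σ| ≤ B) ∧ DependsOn G (Λ : Set V) with hAdm
  set Lip : ((V → S) → ℝ) → (↥Λ → ℝ) → Prop := fun G δ' => (∀ x, 0 ≤ δ' x) ∧
    ∀ (x : ↥Λ) (σ τ : V → S), (∀ v, v ≠ x.1 → σ v = τ v) → |G σ - G τ| ≤ δ' x * r (σ x.1) (τ x.1)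
    with hLip
  have lipV : ∀ {G : (V → S) → ℝ} {δ' : ↥Λ → ℝ}, Adm G → Lip G δ' → IsLipBound r G (ext δ') := by
    rintro G δ' ⟨-, -, hGdep⟩ ⟨hδ'0, hδ'⟩
    refine ⟨fun v => ?_, fun v σ τ hστ => ?_⟩
    · by_cases hv : v ∈ Λ
      · rw [show ext δ' v = δ' ⟨v, hv⟩ from ext_apply δ' ⟨v, hv⟩]; exact hδ'0 _
      · rw [ext_of_not_mem δ' hv]
    · by_cases hv : v ∈ Λ
      · rw [show ext δ' v = δ' ⟨v, hv⟩ from ext_apply δ' ⟨v, hv⟩]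
        exact hδ' ⟨v, hv⟩ σ τ hστ
      · rw [ext_of_not_mem δ' hv, zero_mul]
        rw [hGdep fun u hu => hστ u fun huv => hv (huv ▸ Finset.mem_coe.1 hu), sub_self, abs_zero]
  set T : ↥Λ → ((V → S) → ℝ) → ((V → S) → ℝ) := fun c G =>
    if Gen c.1 then fun σ => ∫ τ, G τ ∂(γ (win c.1) (Λ.piecewise σ ω))
    else fun σ => G (Function.update σ c.1 (ω c.1)) with hT
  set win' : ↥Λ → Finset ↥Λ := fun c =>
    if Gen c.1 then (win c.1).subtype (· ∈ Λ) else {c} with hwin'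
  set k' : ↥Λ → ↥Λ → ↥Λ → ℝ := fun c y x => if Gen c.1 then K c.1 y.1 x.1 else 0 with hk'
  set U : Finset ↥Λ := Finset.univ.filter fun c => Gen c.1 with hUdef
  -- membership in the two kinds of windows
  have mem_win'_gen : ∀ {c x : ↥Λ}, Gen c.1 → (x ∈ win' c ↔ x.1 ∈ win c.1) :=
    fun {c x} hc => by simp only [hwin', if_pos hc, Finset.mem_subtype]
  have mem_win'_frz : ∀ {c x : ↥Λ}, ¬ Gen c.1 → (x ∈ win' c ↔ x = c) :=
    fun {c x} hc => by simp only [hwin', if_neg hc, Finset.mem_singleton]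
  have mem_win_of_mem_win' : ∀ {c x : ↥Λ}, x ∈ win' c → x.1 ∈ win c.1 := fun {c x} hx => by
    by_cases hc : Gen c.1
    · exact (mem_win'_gen hc).1 hx
    · rw [(mem_win'_frz hc).1 hx]; exact hself _ c.2
  -- a cell of positive profile lies only in genuine windows
  have gen_of_pos : ∀ {x : ↥Λ} {c : V}, ℓ x.1 ≠ 0 → x.1 ∈ win c → c ∈ Λ ∧ Gen c :=
    fun {x c} hx hxc => ⟨(hU x.1 hx c hxc).1, (hU x.1 hx c hxc).2⟩
  -- (hlip0)
  have hlip0 : ∀ ⦃G : (V → S) → ℝ⦄ ⦃δ' : ↥Λ → ℝ⦄, Lip G δ' → ∀ x, 0 ≤ δ' x := fun G δ' h => h.1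
  -- (hosc) interpolation on the sites of `Λ`
  have hoscA : ∀ ⦃G : (V → S) → ℝ⦄ ⦃δ' : ↥Λ → ℝ⦄, Adm G → Lip G δ' →
      ∀ σ τ, |G σ - G τ| ≤ R * ∑ x, δ' x := by
    intro G δ' hG hδ' σ τ
    have h := abs_sub_le_mul_sum_of_dependsOn hrR hG.2.2 (lipV hG hδ') σ τ
    have hs : ∑ y ∈ Λ, ext δ' y = ∑ x : ↥Λ, δ' x := by
      rw [← Finset.sum_coe_sort]
      exact Finset.sum_congr rfl fun x _ => ext_apply δ' x
    rwa [hs] at h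
  -- (hk)
  have hk : ∀ c y x, 0 ≤ k' c y x := fun c y x => by
    simp only [hk']; split_ifs; exacts [hK0 _ _ _, le_rfl]
  -- (hT) the window operators preserve admissibility
  have hTA : ∀ ⦃G : (V → S) → ℝ⦄ (c : ↥Λ), Adm G → Adm (T c G) := by
    rintro G c ⟨hGm, ⟨B', hB'⟩, hGdep⟩
    by_cases hc : Gen c.1
    · simp only [hT, if_pos hc]
      refine ⟨(measurable_windowAvg' hγ (win c.1) hGm).comp (measurable_piecewise_conf Λ ω),
        ⟨B', fun σ => abs_windowAvg_le' hγ (win c.1) hB' _⟩, fun σ σ' hσ => ?_⟩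
      have : Λ.piecewise σ ω = Λ.piecewise σ' ω := by
        funext v
        by_cases hv : v ∈ Λ
        · rw [Finset.piecewise_eq_of_mem _ _ _ hv, Finset.piecewise_eq_of_mem _ _ _ hv]
          exact hσ v (Finset.mem_coe.2 hv)
        · rw [Finset.piecewise_eq_of_notMem _ _ _ hv, Finset.piecewise_eq_of_notMem _ _ _ hv]
      simp only [this]
    · simp only [hT, if_neg hc]
      refine ⟨hGm.comp (measurable_update_const'' c.1 (ω c.1)), ⟨B', fun σ => hB' _⟩,
        fun σ σ' hσ => hGdep fun v hv => ?_⟩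
      by_cases hvc : v = c.1
      · subst hvc; simp
      · rw [Function.update_of_ne hvc, Function.update_of_ne hvc]; exact hσ v hv
  -- (hdust) the window dusting estimate
  have hdust : ∀ ⦃G : (V → S) → ℝ⦄ ⦃δ' : ↥Λ → ℝ⦄ (c : ↥Λ), Adm G → Lip G δ' →
      Lip (T c G) fun y => if y ∈ win' c then 0 else δ' y + ∑ x ∈ win' c, k' c y x * δ' x := by
    intro G δ' c hG hδ'
    have hGV := lipV hG hδ'
    obtain ⟨hGm, ⟨B', hB'⟩, hGdep⟩ := hG
    refine ⟨fun y => ?_, fun y σ τ hστ => ?_⟩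
    · dsimp only
      split_ifs
      · exact le_rfl
      · exact add_nonneg (hδ'.1 y) (Finset.sum_nonneg fun x _ => mul_nonneg (hk c y x) (hδ'.1 x))
    by_cases hc : Gen c.1
    · -- a genuine window: the tree's window dusting estimate with the exterior frozen to `ω`
      have hwinΛ : win c.1 ⊆ Λ := hc.1
      have hωη : ∀ v, id v ≠ y.1 → Λ.piecewise σ ω v = Λ.piecewise τ ω v := fun v hv => by
        by_cases hvΛ : v ∈ Λ
        · rw [Finset.piecewise_eq_of_mem _ _ _ hvΛ, Finset.piecewise_eq_of_mem _ _ _ hvΛ]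
          exact hστ v hv
        · rw [Finset.piecewise_eq_of_notMem _ _ _ hvΛ, Finset.piecewise_eq_of_notMem _ _ _ hvΛ]
      have key := lip_windowAvg (ι := V) (cell := id) (w := fun x σ τ => r (σ x) (τ x)) hγ
        (fun x σ σ' τ τ' hσ hτ => by simp only [hσ x rfl, hτ x rfl])
        (Λ := win c.1) (W := win c.1) (fun v => Iff.rfl) (kc := K c.1) (hcontract c.1) hGm hB'
        hGV.nonneg hGV.le y.1 (Λ.piecewise σ ω) (Λ.piecewise τ ω) hωη
      have hry : r (Λ.piecewise σ ω y.1) (Λ.piecewise τ ω y.1) = r (σ y.1) (τ y.1) := by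
        rw [Finset.piecewise_eq_of_mem _ _ _ y.2, Finset.piecewise_eq_of_mem _ _ _ y.2]
      have hsumeq : ∑ x ∈ win c.1, K c.1 y.1 x * ext δ' x = ∑ x ∈ win' c, k' c y x * δ' x := by
        simp only [hwin', hk', if_pos hc]
        rw [← Finset.sum_subtype_of_mem (f := fun x => K c.1 y.1 x * ext δ' x) fun x hx => hwinΛ hx]
        exact Finset.sum_congr rfl fun x _ => by rw [ext_apply]
      have hmem : (y.1 ∈ win c.1) ↔ (y ∈ win' c) := (mem_win'_gen hc).symm
      simp only [hT, if_pos hc]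
      rw [hry, hsumeq, ext_apply] at key
      simp only [hmem] at key
      exact key
    · -- a frozen centre: the operator freezes the site `c`, its window is `{c}`, its array is `0`
      simp only [hT, if_neg hc]
      by_cases hyc : y = c
      · subst hyc
        have : Function.update σ y.1 (ω y.1) = Function.update τ y.1 (ω y.1) := by
          funext v
          by_cases hv : v = y.1
          · subst hv; simp
          · rw [Function.update_of_ne hv, Function.update_of_ne hv]; exact hστ v hv
        rw [this, sub_self, abs_zero]
        exact mul_nonneg (by
          split_ifs
          · exact le_rfl
          · exact add_nonneg (hδ'.1 y)
              (Finset.sum_nonneg fun x _ => mul_nonneg (hk y y x) (hδ'.1 x))) (hr0 _ _)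
      · have hy1 : y.1 ≠ c.1 := fun h => hyc (Subtype.ext h)
        have h := hδ'.2 y (Function.update σ c.1 (ω c.1)) (Function.update τ c.1 (ω c.1))
          fun v hv => by
            by_cases hvc : v = c.1
            · subst hvc; simp
            · rw [Function.update_of_ne hvc, Function.update_of_ne hvc]; exact hστ v hv
        rw [Function.update_of_ne hy1, Function.update_of_ne hy1] at h
        refine h.trans (mul_le_mul_of_nonneg_right ?_ (hr0 _ _))
        rw [if_neg (fun h' => hyc ((mem_win'_frz hc).1 h'))]
        simp only [hk', if_neg hc, zero_mul, Finset.sum_const_zero, add_zero, le_refl]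
  -- the functionals are monotone-normalised
  have hle : ∀ (ζ : V → S) ⦃G : (V → S) → ℝ⦄ ⦃M : ℝ⦄, Adm G → (∀ σ, G σ ≤ M) →
      ∫ σ, G σ ∂(γ Λ ζ) ≤ M := by
    rintro ζ G M ⟨hGm, ⟨B', hB'⟩, -⟩ hM
    haveI := hγ.isProbability Λ ζ
    calc ∫ σ, G σ ∂(γ Λ ζ) ≤ ∫ _σ, M ∂(γ Λ ζ) :=
          integral_mono (integrable_of_abs_le' hGm hB') (integrable_const M) hM
      _ = M := by simp
  have hge : ∀ (ζ : V → S) ⦃G : (V → S) → ℝ⦄ ⦃M : ℝ⦄, Adm G → (∀ σ, M ≤ G σ) →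
      M ≤ ∫ σ, G σ ∂(γ Λ ζ) := by
    rintro ζ G M ⟨hGm, ⟨B', hB'⟩, -⟩ hM
    haveI := hγ.isProbability Λ ζ
    calc M = ∫ _σ, M ∂(γ Λ ζ) := by simp
      _ ≤ ∫ σ, G σ ∂(γ Λ ζ) := integral_mono (integrable_const M) (integrable_of_abs_le' hGm hB') hM
  -- a genuine window operator IS the window kernel on admissible observables, at every configuration
  -- agreeing with `ω` on the exterior part of the locality set (locality)
  have hTgen : ∀ ⦃G : (V → S) → ℝ⦄ (c : ↥Λ), Gen c.1 → Adm G →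
      ∀ σ, (∀ v ∈ nbhd c.1, v ∉ Λ → σ v = ω v) → T c G σ = ∫ τ, G τ ∂(γ (win c.1) σ) := by
    rintro G c hc ⟨hGm, ⟨B', hB'⟩, hGdep⟩ σ hσ
    simp only [hT, if_pos hc]
    have hdep' : DependsOn G ((Λ ∪ nbhd c.1 : Finset V) : Set V) :=
      hGdep.mono fun v hv => Finset.mem_coe.2 (Finset.mem_union_left _ (Finset.mem_coe.1 hv))
    refine windowAvg_congr_of_local hγ (Finset.subset_union_right) (hloc c.1) hGm hB' hdep'
      fun v hv => ?_
    by_cases hvΛ : v ∈ Λ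
    · exact Finset.piecewise_eq_of_mem _ _ _ hvΛ
    · rw [Finset.piecewise_eq_of_notMem _ _ _ hvΛ]
      rcases Finset.mem_union.1 hv with h | h
      · exact absurd h hvΛ
      · exact (hσ v h hvΛ).symm
  -- hence both kernels are invariant under the genuine window operators (properness + consistency)
  have hinv : ∀ (ζ : V → S), (∀ c, Gen c → ∀ v ∈ nbhd c, v ∉ Λ → ζ v = ω v) →
      ∀ ⦃G : (V → S) → ℝ⦄ (c : ↥Λ), c ∈ U → Adm G →
      ∫ σ, T c G σ ∂(γ Λ ζ) = ∫ σ, G σ ∂(γ Λ ζ) := by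
    intro ζ hζ G c hc hG
    have hc' : Gen c.1 := (Finset.mem_filter.1 hc).2
    have hTG := hTgen c hc' hG
    obtain ⟨hGm, ⟨B', hB'⟩, -⟩ := hG
    haveI := hγ.isProbability Λ ζ
    -- under `γ_Λ(·|ζ)` the configuration is `ζ = ω` on the exterior part of `nbhd c`, a.e.
    have hae : ∀ᵐ σ ∂(γ Λ ζ), T c G σ = ∫ τ, G τ ∂(γ (win c.1) σ) := by
      filter_upwards [hγ.proper Λ ζ] with σ hσ
      exact hTG σ fun v hv hvΛ => by rw [hσ v hvΛ]; exact hζ c.1 hc' v hv hvΛ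
    rw [integral_congr_ae hae]
    exact hγ.integral_integral_consistent hc'.1 ζ (integrable_of_abs_le' hGm hB')
  have hζω : ∀ c, Gen c → ∀ v ∈ nbhd c, v ∉ Λ → ω v = ω v := fun _ _ _ _ _ => rfl
  have hζη : ∀ c, Gen c → ∀ v ∈ nbhd c, v ∉ Λ → η v = ω v :=
    fun c hc v hv hvΛ => (hc.2 v hv hvΛ).symm
  -- profile hypotheses on `↥Λ`
  have hUι : ∀ x : ↥Λ, ℓ x.1 ≠ 0 → ∀ c : ↥Λ, x ∈ win' c → c ∈ U := by
    intro x hx c hxc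
    refine Finset.mem_filter.2 ⟨Finset.mem_univ _, ?_⟩
    by_cases hc : Gen c.1
    · exact hc
    · rw [(mem_win'_frz hc).1 hxc] at hx
      exact (gen_of_pos hx (hself c.1 c.2)).2
  have hℓι : ∀ c x y : ↥Λ, x ∈ win' c → k' c y x ≠ 0 → ℓ x.1 ≤ ℓ y.1 + 1 := by
    intro c x y hxc hkc
    by_cases hc : Gen c.1
    · simp only [hk', if_pos hc] at hkc
      exact hℓ c.1 x.1 y.1 ((mem_win'_gen hc).1 hxc) hkc
    · simp only [hk', if_neg hc, ne_eq, not_true_eq_false] at hkc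
  -- received sums on `↥Λ`: a genuine window contributes at most its full received sum, a frozen one `0`
  have hrecv : ∀ x : ↥Λ, ∑ c ∈ Finset.univ.filter (fun c => x ∈ win' c), ∑ y, k' c y x ≤
      ∑ c ∈ cover x.1, ∑ y ∈ (nbhd c).filter (· ∈ Y), K c y x.1 := by
    intro x
    -- each term is bounded by the corresponding term of the cover
    have hterm : ∀ c : ↥Λ, x ∈ win' c → ∑ y, k' c y x ≤
        (if Gen c.1 then ∑ y ∈ (nbhd c.1).filter (· ∈ Y), K c.1 y x.1 else 0) := by
      intro c hxc
      by_cases hgen : Gen c.1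
      · simp only [hk', if_pos hgen]
        have h1 : ∑ y : ↥Λ, K c.1 y.1 x.1 = ∑ y ∈ Λ, K c.1 y x.1 :=
          Finset.sum_coe_sort Λ (fun y => K c.1 y x.1)
        rw [h1, ← Finset.sum_filter_add_sum_filter_not Λ (fun y => y ∈ nbhd c.1)]
        have h2 : ∑ y ∈ Λ.filter (fun y => y ∉ nbhd c.1), K c.1 y x.1 = 0 :=
          Finset.sum_eq_zero fun y hy => by
            by_contra h
            exact (Finset.mem_filter.1 hy).2 (hKsupp _ _ _ h)
        rw [h2, add_zero]
        exact Finset.sum_le_sum_of_subset_of_nonneg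
          (fun y hy => Finset.mem_filter.2 ⟨(Finset.mem_filter.1 hy).2,
            hΛY (Finset.mem_coe.2 (Finset.mem_filter.1 hy).1)⟩)
          fun y _ _ => hK0 _ _ _
      · simp only [hk', if_neg hgen, Finset.sum_const_zero, le_refl]
    -- genuine centres around `x` inject into the cover of `x`
    calc ∑ c ∈ Finset.univ.filter (fun c => x ∈ win' c), ∑ y, k' c y x
        ≤ ∑ c ∈ Finset.univ.filter (fun c => x ∈ win' c),
            (if Gen c.1 then ∑ y ∈ (nbhd c.1).filter (· ∈ Y), K c.1 y x.1 else 0) :=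
          Finset.sum_le_sum fun c hc => hterm c (Finset.mem_filter.1 hc).2
      _ = ∑ c ∈ (Finset.univ.filter (fun c => x ∈ win' c)).filter (fun c => Gen c.1),
            ∑ y ∈ (nbhd c.1).filter (· ∈ Y), K c.1 y x.1 :=
          (Finset.sum_filter (fun c : ↥Λ => Gen c.1)
            (fun c : ↥Λ => ∑ y ∈ (nbhd c.1).filter (· ∈ Y), K c.1 y x.1)).symm
      _ = ∑ v ∈ ((Finset.univ.filter (fun c => x ∈ win' c)).filter (fun c => Gen c.1)).image
            (Subtype.val : ↥Λ → V), ∑ y ∈ (nbhd v).filter (· ∈ Y), K v y x.1 := by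
          rw [Finset.sum_image fun a _ b _ h => Subtype.ext h]
      _ ≤ ∑ c ∈ cover x.1, ∑ y ∈ (nbhd c).filter (· ∈ Y), K c y x.1 := by
          refine Finset.sum_le_sum_of_subset_of_nonneg (fun v hv => ?_) fun c _ _ =>
            Finset.sum_nonneg fun y _ => hK0 _ _ _
          obtain ⟨c, hc, rfl⟩ := Finset.mem_image.1 hv
          obtain ⟨hc1, hc2⟩ := Finset.mem_filter.1 hc
          exact (hcover c.1 x.1).1 ((mem_win'_gen hc2).1 (Finset.mem_filter.1 hc1).2)
  have hsum0ι : ∀ x : ↥Λ, ∑ c ∈ Finset.univ.filter (fun c => x ∈ win' c), ∑ y, k' c y x ≤ Γ :=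
    fun x => (hrecv x).trans (hsum0 x.1)
  have hsumι : ∀ x : ↥Λ, ℓ x.1 ≠ 0 → ∑ c ∈ Finset.univ.filter (fun c => x ∈ win' c), ∑ y, k' c y x ≤
      γ₀ * (Finset.univ.filter fun c => x ∈ win' c).card := by
    intro x hx
    refine (hrecv x).trans ((hsum x.1).trans (mul_le_mul_of_nonneg_left ?_ hγ₀))
    -- around a cell of positive profile every centre of the cover is a genuine centre of `↥Λ`
    have hinj : (cover x.1).card ≤ (Finset.univ.filter fun c : ↥Λ => x ∈ win' c).card := by
      refine Finset.card_le_card_of_injOn (fun c => if h : c ∈ Λ then ⟨c, h⟩ else x) (fun c hc => ?_) ?_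
      · have hxc : x.1 ∈ win c := (hcover c x.1).2 (Finset.mem_coe.1 hc)
        obtain ⟨hcΛ, hgen⟩ := gen_of_pos hx hxc
        simp only [dif_pos hcΛ]
        exact Finset.mem_coe.2 (Finset.mem_filter.2 ⟨Finset.mem_univ _, (mem_win'_gen hgen).2 hxc⟩)
      · intro a ha b hb hab
        have haΛ : a ∈ Λ := (gen_of_pos hx ((hcover a x.1).2 (Finset.mem_coe.1 ha))).1
        have hbΛ : b ∈ Λ := (gen_of_pos hx ((hcover b x.1).2 (Finset.mem_coe.1 hb))).1
        simp only [dif_pos haΛ, dif_pos hbΛ] at hab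
        exact congrArg Subtype.val hab
    exact_mod_cast hinj
  have hselfι : ∀ x : ↥Λ, x ∈ win' x := fun x => by
    by_cases hc : Gen x.1
    · exact (mem_win'_gen hc).2 (hself x.1 x.2)
    · exact (mem_win'_frz hc).2 rfl
  -- the data of `F`
  have hFA : Adm F := ⟨hFm, ⟨B, hB⟩, hFdep⟩
  have hδι : Lip F fun x : ↥Λ => δ x.1 :=
    ⟨fun x => hδ.nonneg x.1, fun x σ τ hστ => hδ.le x.1 σ τ hστ⟩
  have hδ0ι : ∀ x : ↥Λ, ℓ x.1 < L₀ → (fun x : ↥Λ => δ x.1) x = 0 := fun x hx => hδL x.1 hx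
  -- the finite-cell window comparison theorem, bulk form
  have key := abs_sub_le_exp_bulk (ι := ↥Λ) (Ω := V → S) (Adm := Adm) (Lip := Lip) (T := T)
    (win := win') (k := k') (U := U) (E₁ := fun G => ∫ σ, G σ ∂(γ Λ ω))
    (E₂ := fun G => ∫ σ, G σ ∂(γ Λ η)) hR hlip0 hoscA hk hTA hdust (hle ω) (hge ω)
    (fun G c hc hG => hinv ω hζω c hc hG) (hle η) (hge η) (fun G c hc hG => hinv η hζη c hc hG)
    hγ₀ hγ₁ hΓ (fun x : ↥Λ => ℓ x.1) hUι hℓι hsum0ι hsumι hselfι L₀ hFA hδι hδ0ι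
  have hs : ∑ x : ↥Λ, δ x.1 = ∑ x ∈ Λ, δ x := Finset.sum_coe_sort Λ δ
  rw [hs] at key
  exact key

/-! ### Uniqueness in a region with frozen exterior -/

/-- **Two solutions of the DLR system on a region `W` with frozen exterior agree on bounded local
Lipschitz observables, under the averaged window condition** (Dobrushin–Shlosman 1985 Thm. 1 / Georgii
2011 Thm. 8.20, window form): let `μ, ν` be probability measures concentrated on `{σ = ζ off W}` that
satisfy the DLR equations for the kernels `γ_Λ`, `Λ ⊆ W` finite; suppose every finite `Δ` and depth `L₀`
admit a finite `Λ ⊆ W`, `Δ ⊆ Λ`, and a profile `ℓ ≥ L₀` on `Δ`, dropping by at most one along the support of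
`K`, whose positive-profile windows have centre and window in `Λ` and read the exterior of `Λ` only in the
frozen set `Wᶜ`. Then `∫ F dμ = ∫ F dν` for every bounded measurable local `F` with a site-Lipschitz vector
(`μ F − ν F = ∫∫ [γ_Λ F(ω) − γ_Λ F(η)] dμ(ω) dν(η)` with `ω = ζ = η` off `W` almost surely, and
`abs_integral_sub_integral_le_of_window_bulk`). [cite: DobrushinShlosman1985, Theorem 1] -/
theorem integral_eq_of_dlrOn_window_bulk [DecidableEq V] {γ : Specification V S}
    (hγ : IsSpecification γ)
    {r : S → S → ℝ} {R : ℝ} (hr0 : ∀ a b, 0 ≤ r a b) (hrR : ∀ a b, r a b ≤ R) (hR : 0 ≤ R)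
    {win nbhd : V → Finset V} {K : V → V → V → ℝ} (hK0 : ∀ c y x, 0 ≤ K c y x)
    (hKsupp : ∀ c y x, K c y x ≠ 0 → y ∈ nbhd c)
    (hcontract : ∀ (c y : V), y ∉ win c → ∀ (ω η : V → S), (∀ v, v ≠ y → ω v = η v) →
      ∀ (f : (V → S) → ℝ) (δ : V → ℝ), Measurable f → (∃ B, ∀ σ, |f σ| ≤ B) →
        DependsOn f (win c : Set V) → (∀ x, 0 ≤ δ x) →
        (∀ (x : V) (σ τ : V → S), (∀ v, v ≠ x → σ v = τ v) → |f σ - f τ| ≤ δ x * r (σ x) (τ x)) →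
          |∫ σ, f σ ∂(γ (win c) ω) - ∫ σ, f σ ∂(γ (win c) η)| ≤
            (∑ x ∈ win c, K c y x * δ x) * r (ω y) (η y))
    (hloc : ∀ (c : V) (ζ ζ' : V → S), (∀ v ∈ nbhd c, ζ v = ζ' v) →
      ∀ (f : (V → S) → ℝ), Measurable f → (∃ B, ∀ σ, |f σ| ≤ B) → DependsOn f (win c : Set V) →
        ∫ σ, f σ ∂(γ (win c) ζ) = ∫ σ, f σ ∂(γ (win c) ζ'))
    {W : Set V} [DecidablePred (· ∈ W)] (hself : ∀ c, c ∈ W → c ∈ win c)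
    (cover : V → Finset V) (hcover : ∀ c x, x ∈ win c ↔ c ∈ cover x)
    {γ₀ Γ : ℝ} (hγ₀ : 0 ≤ γ₀) (hγ₁ : γ₀ < 1) (hΓ : 0 ≤ Γ)
    (hsum0 : ∀ x, ∑ c ∈ cover x, ∑ y ∈ (nbhd c).filter (· ∈ W), K c y x ≤ Γ)
    (hsum : ∀ x, ∑ c ∈ cover x, ∑ y ∈ (nbhd c).filter (· ∈ W), K c y x ≤ γ₀ * (cover x).card)
    (hexh : ∀ (Δ : Finset V) (L₀ : ℕ), ∃ (Λ : Finset V) (ℓ : V → ℕ), Δ ⊆ Λ ∧ (↑Λ : Set V) ⊆ W ∧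
      (∀ x, ℓ x ≠ 0 → ∀ c, x ∈ win c → c ∈ Λ ∧ win c ⊆ Λ ∧ ∀ v ∈ nbhd c, v ∉ Λ → v ∉ W) ∧
      (∀ c x y, x ∈ win c → K c y x ≠ 0 → ℓ x ≤ ℓ y + 1) ∧ (∀ x ∈ Δ, L₀ ≤ ℓ x))
    (ζ : V → S) {μ ν : Measure (V → S)} [IsProbabilityMeasure μ] [IsProbabilityMeasure ν]
    (hμζ : ∀ᵐ σ ∂μ, ∀ z ∉ W, σ z = ζ z) (hνζ : ∀ᵐ σ ∂ν, ∀ z ∉ W, σ z = ζ z)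
    (hμ : ∀ Λ : Finset V, (↑Λ : Set V) ⊆ W →
      ∀ A : Set (V → S), MeasurableSet A → ∫⁻ η, γ Λ η A ∂μ = μ A)
    (hν : ∀ Λ : Finset V, (↑Λ : Set V) ⊆ W →
      ∀ A : Set (V → S), MeasurableSet A → ∫⁻ η, γ Λ η A ∂ν = ν A)
    {F : (V → S) → ℝ} (hFm : Measurable F) {B : ℝ} (hB : ∀ σ, |F σ| ≤ B) {Δ : Finset V}
    (hFdep : DependsOn F (Δ : Set V)) {δ : V → ℝ} (hδ : IsLipBound r F δ) :
    ∫ σ, F σ ∂μ = ∫ σ, F σ ∂ν := by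
  -- adapted from `DobrushinShlosman.integral_eq_integral_of_window` (DLR on `W` only; a.e. frozen exterior)
  classical
  set κ₁ : ℝ := (1 - γ₀) ^ 2 / (2 * (2 * Γ + 1)) with hκ₁
  have hκ₁pos : 0 < κ₁ := by
    have h1 : 0 < 1 - γ₀ := sub_pos.2 hγ₁
    rw [hκ₁]; positivity
  -- the Lipschitz vector cut down to `Δ`
  set δΔ : V → ℝ := fun x => if x ∈ Δ then δ x else 0 with hδΔ
  have hδΔ' : IsLipBound r F δΔ := hδ.restrict hFdep
  set SΔ : ℝ := ∑ x ∈ Δ, δ x with hSΔ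
  -- the bound at every depth
  have step : ∀ L₀ : ℕ, |∫ σ, F σ ∂μ - ∫ σ, F σ ∂ν| ≤ 2 * R * Real.exp (-(κ₁ * L₀)) * SΔ := by
    intro L₀
    obtain ⟨Λ, ℓ, hΔΛ, hΛW, hUΛ, hℓΛ, hLΛ⟩ := hexh Δ L₀
    have hFdepΛ : DependsOn F (Λ : Set V) :=
      hFdep.mono fun v hv => Finset.mem_coe.2 (hΔΛ (Finset.mem_coe.1 hv))
    have hδL : ∀ x, ℓ x < L₀ → δΔ x = 0 := fun x hx => by
      simp only [hδΔ]
      split_ifs with hxΔ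
      · exact absurd (hLΛ x hxΔ) (not_le.2 hx)
      · rfl
    -- the two-boundary-condition bound, for boundary conditions frozen to `ζ` off `W`
    have hpair : ∀ ω η : V → S, (∀ z ∉ W, ω z = ζ z) → (∀ z ∉ W, η z = ζ z) →
        |∫ σ, F σ ∂(γ Λ ω) - ∫ σ, F σ ∂(γ Λ η)| ≤ 2 * R * Real.exp (-(κ₁ * L₀)) * SΔ := by
      intro ω η hω hη
      have hU' : ∀ x, ℓ x ≠ 0 → ∀ c, x ∈ win c →
          c ∈ Λ ∧ win c ⊆ Λ ∧ ∀ v ∈ nbhd c, v ∉ Λ → ω v = η v := by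
        intro x hx c hxc
        obtain ⟨h1, h2, h3⟩ := hUΛ x hx c hxc
        exact ⟨h1, h2, fun v hv hvΛ => by rw [hω v (h3 v hv hvΛ), hη v (h3 v hv hvΛ)]⟩
      have h := abs_integral_sub_integral_le_of_window_bulk hγ hr0 hrR hR hK0 hKsupp
        hcontract hloc W cover hcover hγ₀ hγ₁ hΓ hsum0 hsum Λ hΛW (fun c hc => hself c (hΛW hc))
        ω η ℓ L₀ hU' hℓΛ hFm hB hFdepΛ hδΔ' hδL
      have hs : ∑ x ∈ Λ, δΔ x = SΔ := by
        rw [hSΔ, hδΔ, Finset.sum_ite_mem, Finset.inter_eq_right.2 hΔΛ]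
      rw [hs] at h
      exact h
    -- DLR on `Λ ⊆ W`: `μ F = ∫ γ_Λ F dμ`, `ν F = ∫ γ_Λ F dν`
    rw [← integral_integral_eq_of_dlr' hγ Λ (hμ Λ hΛW) (integrable_of_abs_le' hFm hB),
      ← integral_integral_eq_of_dlr' hγ Λ (hν Λ hΛW) (integrable_of_abs_le' hFm hB)]
    exact abs_integral_sub_integral_le_of_osc_ae (measurable_windowAvg' hγ Λ hFm)
      (fun σ => abs_windowAvg_le' hγ Λ hB σ) hμζ hνζ fun ω η hω hη => hpair ω η hω hη
  -- let the depth tend to infinity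
  have hlim : Filter.Tendsto (fun L₀ : ℕ => 2 * R * Real.exp (-(κ₁ * L₀)) * SΔ) Filter.atTop
      (nhds (2 * R * 0 * SΔ)) := by
    refine ((tendsto_const_nhds.mul ?_).mul tendsto_const_nhds)
    have h1 : Filter.Tendsto (fun L₀ : ℕ => κ₁ * (L₀ : ℝ)) Filter.atTop Filter.atTop :=
      Filter.Tendsto.const_mul_atTop hκ₁pos tendsto_natCast_atTop_atTop
    exact Real.tendsto_exp_neg_atTop_nhds_zero.comp h1
  rw [mul_zero, zero_mul] at hlim
  have h0 : |∫ σ, F σ ∂μ - ∫ σ, F σ ∂ν| ≤ 0 :=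
    ge_of_tendsto hlim (Filter.Eventually.of_forall step)
  have := abs_nonneg (∫ σ, F σ ∂μ - ∫ σ, F σ ∂ν)
  exact sub_eq_zero.1 (abs_eq_zero.1 (le_antisymm h0 this))

section Determine

variable {M : Type*} [PseudoMetricSpace M] [MeasurableSpace M] [BorelSpace M]

/-- ★ **Uniqueness of the solution of the DLR system on a region with frozen exterior, under the averaged
Dobrushin–Shlosman window condition** (Dobrushin–Shlosman 1985 Thm. 1 — `C_V` implies uniqueness — in
Georgii's «no phase transition in a subvolume» form, Thm. 8.20; Vasserstein form for an arbitrary measurable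
spin space whose σ-algebra is induced by a map `val` into a metric space with `dist ∘ val ≤ A · r`, so that
bounded local `r`-Lipschitz observables determine probability measures). Hypotheses as in
`integral_eq_of_dlrOn_window_bulk`; conclusion `μ = ν`. [cite: DobrushinShlosman1985, Theorem 1] -/
theorem measure_eq_of_dlrOn_window_bulk [DecidableEq V] {γ : Specification V S}
    (hγ : IsSpecification γ)
    {r : S → S → ℝ} {R : ℝ} (hr0 : ∀ a b, 0 ≤ r a b) (hrR : ∀ a b, r a b ≤ R) (hR : 0 ≤ R)
    {win nbhd : V → Finset V} {K : V → V → V → ℝ} (hK0 : ∀ c y x, 0 ≤ K c y x)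
    (hKsupp : ∀ c y x, K c y x ≠ 0 → y ∈ nbhd c)
    (hcontract : ∀ (c y : V), y ∉ win c → ∀ (ω η : V → S), (∀ v, v ≠ y → ω v = η v) →
      ∀ (f : (V → S) → ℝ) (δ : V → ℝ), Measurable f → (∃ B, ∀ σ, |f σ| ≤ B) →
        DependsOn f (win c : Set V) → (∀ x, 0 ≤ δ x) →
        (∀ (x : V) (σ τ : V → S), (∀ v, v ≠ x → σ v = τ v) → |f σ - f τ| ≤ δ x * r (σ x) (τ x)) →
          |∫ σ, f σ ∂(γ (win c) ω) - ∫ σ, f σ ∂(γ (win c) η)| ≤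
            (∑ x ∈ win c, K c y x * δ x) * r (ω y) (η y))
    (hloc : ∀ (c : V) (ζ ζ' : V → S), (∀ v ∈ nbhd c, ζ v = ζ' v) →
      ∀ (f : (V → S) → ℝ), Measurable f → (∃ B, ∀ σ, |f σ| ≤ B) → DependsOn f (win c : Set V) →
        ∫ σ, f σ ∂(γ (win c) ζ) = ∫ σ, f σ ∂(γ (win c) ζ'))
    {W : Set V} [DecidablePred (· ∈ W)] (hself : ∀ c, c ∈ W → c ∈ win c)
    (cover : V → Finset V) (hcover : ∀ c x, x ∈ win c ↔ c ∈ cover x)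
    {γ₀ Γ : ℝ} (hγ₀ : 0 ≤ γ₀) (hγ₁ : γ₀ < 1) (hΓ : 0 ≤ Γ)
    (hsum0 : ∀ x, ∑ c ∈ cover x, ∑ y ∈ (nbhd c).filter (· ∈ W), K c y x ≤ Γ)
    (hsum : ∀ x, ∑ c ∈ cover x, ∑ y ∈ (nbhd c).filter (· ∈ W), K c y x ≤ γ₀ * (cover x).card)
    (hexh : ∀ (Δ : Finset V) (L₀ : ℕ), ∃ (Λ : Finset V) (ℓ : V → ℕ), Δ ⊆ Λ ∧ (↑Λ : Set V) ⊆ W ∧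
      (∀ x, ℓ x ≠ 0 → ∀ c, x ∈ win c → c ∈ Λ ∧ win c ⊆ Λ ∧ ∀ v ∈ nbhd c, v ∉ Λ → v ∉ W) ∧
      (∀ c x y, x ∈ win c → K c y x ≠ 0 → ℓ x ≤ ℓ y + 1) ∧ (∀ x ∈ Δ, L₀ ≤ ℓ x))
    (val : S → M) (hS : ‹MeasurableSpace S› = MeasurableSpace.comap val ‹MeasurableSpace M›)
    {A : ℝ} (hA0 : 0 ≤ A) (hA : ∀ a b, dist (val a) (val b) ≤ A * r a b)
    (ζ : V → S) {μ ν : Measure (V → S)} [IsProbabilityMeasure μ] [IsProbabilityMeasure ν]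
    (hμζ : ∀ᵐ σ ∂μ, ∀ z ∉ W, σ z = ζ z) (hνζ : ∀ᵐ σ ∂ν, ∀ z ∉ W, σ z = ζ z)
    (hμ : ∀ Λ : Finset V, (↑Λ : Set V) ⊆ W →
      ∀ A : Set (V → S), MeasurableSet A → ∫⁻ η, γ Λ η A ∂μ = μ A)
    (hν : ∀ Λ : Finset V, (↑Λ : Set V) ⊆ W →
      ∀ A : Set (V → S), MeasurableSet A → ∫⁻ η, γ Λ η A ∂ν = ν A) :
    μ = ν := by
  refine measure_eq_of_forall_integral_eq_of_isLipBound val hS fun f Δ δ hfm hdep hf1 hδ => ?_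
  -- an `A δ`-Lipschitz bound for the weight `r` (as in `subsingleton_gibbsMeasures_of_window`)
  have hδ' : IsLipBound r f fun y => A * δ y :=
    ⟨fun y => mul_nonneg hA0 (hδ.nonneg y), fun y σ τ hστ =>
      (hδ.le y σ τ hστ).trans (by
        calc δ y * dist (val (σ y)) (val (τ y)) ≤ δ y * (A * r (σ y) (τ y)) :=
              mul_le_mul_of_nonneg_left (hA _ _) (hδ.nonneg y)
          _ = A * δ y * r (σ y) (τ y) := by ring)⟩
  exact integral_eq_of_dlrOn_window_bulk hγ hr0 hrR hR hK0 hKsupp hcontract hloc hself cover hcover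
    hγ₀ hγ₁ hΓ hsum0 hsum hexh ζ hμζ hνζ hμ hν hfm hf1 hdep hδ'

end Determine

end Literature.Probability.LatticeModels.DobrushinShlosman

end
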